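import Literature.NumberTheory.LFunctions.DobnerLemma3Proofs
import Literature.NumberTheory.LFunctions.BohrAlmostPeriodicProofs
import Literature.NumberTheory.LFunctions.DeBruijnNewmanProofs
import Literature.NumberTheory.LFunctions.Equivalents
import Literature.Analysis.Complex.Hurwitz
import Mathlib.NumberTheory.LSeries.Injectivity
import HarnessLib

/-!
# Dobner's proof of Newman's conjecture — the deduction `Thm. 4 + Thm. 5 + Lemma 3 ⇒ Λ ≥ 0`

Trunk T-ANT (`Literature/NumberTheory/LFunctions`). Proofs only (no definitions, no named facts),
companion of `DobnerNewman.lean`. We prove §3.1 of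

> A. Dobner, *A proof of Newman's conjecture for the extended Selberg class*, Acta Arith. 201
> (2021), 29–62 = arXiv:2005.05142,

for `F = ζ`: from the qualitative Thm. 4 (`Literature.NumberTheory.LFunctions.dobner_xiDeformed_approx`), Bohr's almost
periodicity (`Literature.NumberTheory.LFunctions.bohr_almost_periodic`) and Lemma 3 (`Literature.NumberTheory.LFunctions.dobner_zetaDeformed_exists_zero`), every
`ξ_t` with `t < 0` has a zero off the critical line, i.e. every `H_t`, `t < 0`, has a non-real
zero — which is the tree's `sInf`-free form `Literature.NumberTheory.LFunctions.rodgers_tao` of Newman's conjecture `Λ ≥ 0`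
(`Equivalents.lean`). This gives a second route to `rodgers_tao`, independent of the Rodgers–Tao
decomposition (`RodgersTao*.lean`) and of all zero statistics of `ζ`. Since Lemma 3 and Bohr's
theorem are discharged in `DobnerLemma3Proofs.lean` and `BohrAlmostPeriodicProofs.lean`, the
route's only remaining named fact is the qualitative Thm. 4: `Literature.NumberTheory.LFunctions.rodgers_tao_of_dobner_thm4`.

## The argument (§3.1 of the source, with Hurwitz in place of Rouché)

Fix `t < 0` and a zero `s₀` of the entire function `ζ_t` (Lemma 3); `ζ_t ≢ 0` (`ζ_t(x) → 1` as
`x → +∞`), so `ζ_t ≠ 0` on a small circle `|s − s₀| = r ≤ 1`. For `m = 0, 1, 2, …` choose, by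
Bohr's theorem with `ε = 1/(m+1)` on the strip `|Re s − Re s₀| ≤ 1` and by Thm. 4 with the same
`ε`, a height `T_m` (a Bohr shift, taken large) such that on the disc `|s − s₀| ≤ r`

* `|ζ_t(s) − ζ_t(s + iT_m)| < 1/(m+1)` and
* `|ξ_t(J_t(s + iT_m))/γ_t(s + iT_m) − ζ_t(s + iT_m)| ≤ 1/(m+1)`,
* `Im(s + iT_m) ≥ 1` and `Re J_t(s + iT_m) > ½`.

Then `g_m(s) := ξ_t(J_t(s + iT_m))/γ_t(s + iT_m)` is holomorphic near the disc and `g_m → ζ_t`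
uniformly on it, so by Hurwitz's theorem (`Complex.eventually_exists_zero_mem_ball_of_tendstoUniformlyOn`)
some `g_m` vanishes at some `s` of the disc: `ξ_t(J_t(s')) = 0`, `s' = s + iT_m`, i.e.
`H_t(z) = 0` with `z = −i(2J_t(s') − 1)`, `Im z = 1 − 2 Re J_t(s') < 0`. So `H_t` has a non-real
zero.

## Main results

* `Literature.NumberTheory.LFunctions.rodgers_tao_of_dobner` :
  `dobner_zetaDeformed_exists_zero → dobner_xiDeformed_approx → bohr_almost_periodic → RH.rodgers_tao`.
* `Literature.NumberTheory.LFunctions.rodgers_tao_of_dobner_thm4` : `dobner_xiDeformed_approx → RH.rodgers_tao` (Lemma 3 and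
  Bohr's theorem discharged).

## References

* A. Dobner, op. cit., §3.1 ("Deducing Theorem 2 from Theorem 4"), Thm. 4, Thm. 5, Lemma 3.
* J. B. Conway, *Functions of One Complex Variable I*, 2nd ed., VII.2.5 (Hurwitz).
-/

noncomputable section

open Complex Filter Set Topology Metric

namespace Literature.NumberTheory.LFunctions

/-! ## Auxiliary facts about `J_t`, `γ_t`, `ξ_t` -/

/-- `γ_t(s) ≠ 0` off the real axis. [folklore] -/
theorem dobnerGammaT_ne_zero (t : ℝ) {s : ℂ} (hs : s.im ≠ 0) : dobnerGammaT t s ≠ 0 :=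
  mul_ne_zero (xiGammaFactor_ne_zero_of_im_ne_zero hs) (Complex.exp_ne_zero _)

/-- `J_t` is differentiable on the open upper half-plane. [folklore] -/
theorem differentiableAt_dobnerJ (t : ℝ) {s : ℂ} (hs : 0 < s.im) :
    DifferentiableAt ℂ (dobnerJ t) s := by
  unfold dobnerJ
  refine differentiableAt_id.add (DifferentiableAt.const_mul ?_ _)
  refine (differentiableAt_id.div_const _).clog ?_
  rw [Complex.mem_slitPlane_iff]
  right
  rw [show (s : ℂ) / (2 * (Real.pi : ℂ)) = s / ((2 * Real.pi : ℝ) : ℂ) by push_cast; rfl,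
    Complex.div_ofReal_im]
  exact (div_pos hs (by positivity)).ne'

/-- `γ_t` is differentiable on the open upper half-plane. [folklore] -/
theorem differentiableAt_dobnerGammaT (t : ℝ) {s : ℂ} (hs : 0 < s.im) :
    DifferentiableAt ℂ (dobnerGammaT t) s := by
  unfold dobnerGammaT
  refine DifferentiableAt.mul (differentiableAt_xiGammaFactor (Or.inr hs.ne')) ?_
  · refine DifferentiableAt.cexp (DifferentiableAt.const_mul ?_ _)
    exact (differentiableAt_id.sub (differentiableAt_dobnerJ t hs)).pow 2

/-- `ξ_t` is entire. [folklore] -/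
theorem differentiable_xiDeformed (t : ℝ) : Differentiable ℂ (xiDeformed t) := by
  unfold xiDeformed
  exact ((differentiable_deBruijnH_holds t).comp (by fun_prop)).const_mul _

/-- The real part of `J_t`: `Re J_t(s) = Re s + (|t|/4) log(|s|/(2π))`. [folklore] -/
theorem dobnerJ_re (t : ℝ) (s : ℂ) :
    (dobnerJ t s).re = s.re + |t| / 4 * Real.log (‖s‖ / (2 * Real.pi)) := by
  rw [dobnerJ, Complex.add_re, Complex.re_ofReal_mul, Complex.log_re, norm_div]
  congr 3
  rw [show (2 * (Real.pi : ℂ)) = ((2 * Real.pi : ℝ) : ℂ) by push_cast; rfl, Complex.norm_real,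
    Real.norm_eq_abs, abs_of_pos (by positivity)]

/-- A Bohr sequence tends to infinity: if eventually `τ_{m+1} − τ_m ≥ δ > 0`, then `τ_m` exceeds
any bound. [folklore] -/
theorem exists_ge_of_gaps {τ : ℕ → ℝ} {δ : ℝ} (hδ : 0 < δ) (h : ∀ᶠ m in atTop, δ ≤ τ (m + 1) - τ m)
    (B : ℝ) : ∃ k : ℕ, B ≤ τ k := by
  obtain ⟨k₀, hk₀⟩ := eventually_atTop.1 h
  have hind : ∀ j : ℕ, τ k₀ + δ * j ≤ τ (k₀ + j) := by
    intro j
    induction j with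
    | zero => simp
    | succ j ih =>
      have := hk₀ (k₀ + j) (by omega)
      rw [show k₀ + (j + 1) = k₀ + j + 1 by omega]
      push_cast
      linarith
  obtain ⟨j, hj⟩ := exists_nat_ge ((B - τ k₀) / δ)
  refine ⟨k₀ + j, le_trans ?_ (hind j)⟩
  have := (div_le_iff₀ hδ).1 hj
  linarith

/-- Real and imaginary parts move by at most `r` inside a closed disc of radius `r`. [folklore] -/
theorem abs_re_im_sub_le_of_mem_closedBall {s s₀ : ℂ} {r : ℝ} (hs : s ∈ closedBall s₀ r) :
    |s.re - s₀.re| ≤ r ∧ |s.im - s₀.im| ≤ r := by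
  rw [mem_closedBall, dist_eq_norm] at hs
  exact ⟨by simpa using (abs_re_le_norm (s - s₀)).trans hs,
    by simpa using (abs_im_le_norm (s - s₀)).trans hs⟩

/-! ## The deduction -/

/-- **Newman's conjecture `Λ ≥ 0` from Dobner's Thm. 4, Bohr's theorem and Dobner's Lemma 3**
(Dobner 2021, §3.1, for `F = ζ`): for every `t < 0`, `H_t` has a non-real zero, i.e. the tree's
`Literature.NumberTheory.LFunctions.rodgers_tao`. Hurwitz's theorem replaces Rouché's. [cite: Dobner2021, §3.1] -/
theorem rodgers_tao_of_dobner (h3 : dobner_zetaDeformed_exists_zero)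
    (h4 : dobner_xiDeformed_approx) (h5 : bohr_almost_periodic) : LFunctions.rodgers_tao := by
  intro t ht hreal
  have ht' : 0 < |t| := abs_pos.2 ht.ne
  -- a zero of `ζ_t` and a small circle around it free of zeros
  obtain ⟨s₀, hs₀⟩ := h3 t ht
  set Z : ℂ → ℂ := zetaDeformed t with hZ
  have hZd : Differentiable ℂ Z := differentiable_zetaDeformed ht
  have hZne : ∃ x : ℂ, Z x ≠ 0 := by
    have habs : LSeries.abscissaOfAbsConv (zetaDeformedCoeff t) < ⊤ := by
      rw [abscissaOfAbsConv_zetaDeformed ht]; exact bot_lt_top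
    have hlim := LSeries.tendsto_atTop habs
    have h1 : zetaDeformedCoeff t 1 = 1 := by simp [zetaDeformedCoeff]
    rw [h1] at hlim
    have hev : ∀ᶠ x : ℝ in atTop, LSeries (zetaDeformedCoeff t) x ≠ 0 :=
      hlim.eventually_ne one_ne_zero
    obtain ⟨x, hx⟩ := hev.exists
    exact ⟨x, hx⟩
  have hiso : ∀ᶠ z in 𝓝[≠] s₀, Z z ≠ 0 := by
    rcases (hZd.analyticAt s₀).eventually_eq_zero_or_eventually_ne_zero with h | h
    · exfalso
      obtain ⟨x, hx⟩ := hZne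
      have hall := (hZd.differentiableOn.analyticOnNhd isOpen_univ).eqOn_zero_of_preconnected_of_eventuallyEq_zero
        isPreconnected_univ (mem_univ s₀) h
      exact hx (hall (mem_univ x))
    · exact h
  obtain ⟨ρ, hρ, hρZ⟩ : ∃ ρ > 0, ∀ z : ℂ, 0 < dist z s₀ → dist z s₀ < ρ → Z z ≠ 0 := by
    rw [eventually_nhdsWithin_iff, Metric.eventually_nhds_iff] at hiso
    obtain ⟨ρ, hρ, h⟩ := hiso
    exact ⟨ρ, hρ, fun z h0 hlt ↦ h hlt (dist_pos.1 h0)⟩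
  set r : ℝ := min (ρ / 2) 1 with hr
  have hr0 : 0 < r := lt_min (half_pos hρ) one_pos
  have hr1 : r ≤ 1 := min_le_right _ _
  have hsphere : ∀ z ∈ sphere s₀ r, Z z ≠ 0 := fun z hz ↦ by
    rw [mem_sphere] at hz
    exact hρZ z (by rw [hz]; exact hr0) (by rw [hz]; exact (min_le_left _ _).trans_lt (half_lt_self hρ))
  -- heights
  set A : ℝ := 4 / |t| * (3 / 2 - s₀.re) with hA
  set Y : ℝ := 2 * Real.pi * Real.exp A + |s₀.im| + 2 with hY
  have hT : ∀ m : ℕ, ∃ T : ℝ, Y ≤ T ∧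
      (∀ s : ℂ, s ∈ closedBall s₀ r → ‖Z s - Z (s + T * I)‖ < 1 / (m + 1)) ∧
      (∀ s : ℂ, s ∈ closedBall s₀ r →
        ‖xiDeformed t (dobnerJ t (s + T * I)) - dobnerGammaT t (s + T * I) * Z (s + T * I)‖ ≤
          1 / (m + 1) * ‖dobnerGammaT t (s + T * I)‖) := by
    intro m
    have hε : (0 : ℝ) < 1 / (m + 1) := by positivity
    obtain ⟨y₀, hy₀⟩ := h4 t ht (s₀.re - 1) (s₀.re + 1) (by linarith) (1 / (m + 1)) hε
    obtain ⟨τ, -, -, ⟨δ, hδ, hgap⟩, -, hτ⟩ := h5 (zetaDeformedCoeff t) (s₀.re - 1) (s₀.re + 1)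
      (1 / (m + 1)) (by rw [abscissaOfAbsConv_zetaDeformed ht]; exact EReal.bot_lt_coe _)
      (by linarith) hε
    obtain ⟨k, hk⟩ := exists_ge_of_gaps hδ hgap (max Y (y₀ + |s₀.im| + 1))
    refine ⟨τ k, (le_max_left _ _).trans hk, fun s hs ↦ ?_, fun s hs ↦ ?_⟩
    · have hre : |s.re - s₀.re| ≤ 1 := (abs_re_im_sub_le_of_mem_closedBall hs).1.trans hr1
      obtain ⟨h1, h2⟩ := abs_le.1 hre
      exact hτ k s (by linarith) (by linarith)
    · have hre : |s.re - s₀.re| ≤ 1 := (abs_re_im_sub_le_of_mem_closedBall hs).1.trans hr1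
      have him : |s.im - s₀.im| ≤ 1 := (abs_re_im_sub_le_of_mem_closedBall hs).2.trans hr1
      obtain ⟨h1, h2⟩ := abs_le.1 hre
      obtain ⟨h3, h4'⟩ := abs_le.1 him
      refine hy₀ (s + τ k * I) (by simp; linarith) (by simp; linarith) ?_
      simp only [Complex.add_im, Complex.mul_im, Complex.ofReal_re, Complex.I_im, mul_one,
        Complex.ofReal_im, Complex.I_re, mul_zero, add_zero]
      have := (le_max_right _ _).trans hk
      linarith [le_abs_self s₀.im, neg_abs_le s₀.im]
  choose T hTY hTbohr hTapprox using hT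
  -- the functions `g_m`
  set g : ℕ → ℂ → ℂ := fun m s ↦
    xiDeformed t (dobnerJ t (s + T m * I)) * (dobnerGammaT t (s + T m * I))⁻¹ with hg
  -- imaginary parts on the disc are `≥ 1` after the shift
  have him_shift : ∀ m : ℕ, ∀ s ∈ closedBall s₀ r, 1 ≤ (s + T m * I).im ∧
      T m - |s₀.im| - 1 ≤ (s + T m * I).im := by
    intro m s hs
    have him : |s.im - s₀.im| ≤ 1 := (abs_re_im_sub_le_of_mem_closedBall hs).2.trans hr1
    obtain ⟨h3, h4'⟩ := abs_le.1 him
    simp only [Complex.add_im, Complex.mul_im, Complex.ofReal_re, Complex.I_im, mul_one,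
      Complex.ofReal_im, Complex.I_re, mul_zero, add_zero]
    have hY' : Y ≤ T m := hTY m
    have : |s₀.im| + 2 ≤ Y := by
      rw [hY]; linarith [mul_pos (mul_pos two_pos Real.pi_pos) (Real.exp_pos A)]
    constructor <;> linarith [le_abs_self s₀.im, neg_abs_le s₀.im]
  -- uniform convergence `g_m → ζ_t` on the closed disc
  have hunif : TendstoUniformlyOn g Z atTop (closedBall s₀ r) := by
    rw [Metric.tendstoUniformlyOn_iff]
    intro ε hε
    obtain ⟨M, hM⟩ := exists_nat_gt (2 / ε)
    filter_upwards [eventually_ge_atTop M] with m hm s hs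
    have hm' : (2 : ℝ) / ε < m + 1 := hM.trans (by exact_mod_cast Nat.lt_succ_of_le hm)
    have hεm : 2 * (1 / ((m : ℝ) + 1)) < ε := by
      rw [div_lt_iff₀ hε] at hm'
      rw [mul_one_div, div_lt_iff₀ (by positivity)]
      linarith
    set s' : ℂ := s + T m * I with hs'
    have hs'im : s'.im ≠ 0 := by linarith [(him_shift m s hs).1]
    have hγ : dobnerGammaT t s' ≠ 0 := dobnerGammaT_ne_zero t hs'im
    have e1 : ‖g m s - Z s'‖ ≤ 1 / (m + 1) := by
      have hgs' : g m s = xiDeformed t (dobnerJ t s') * (dobnerGammaT t s')⁻¹ := rfl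
      have : g m s - Z s' = (dobnerGammaT t s')⁻¹ *
          (xiDeformed t (dobnerJ t s') - dobnerGammaT t s' * Z s') := by
        rw [hgs']
        field_simp
      rw [this, norm_mul, norm_inv]
      have h := hTapprox m s hs
      rw [← hs'] at h
      calc ‖dobnerGammaT t s'‖⁻¹ * ‖xiDeformed t (dobnerJ t s') - dobnerGammaT t s' * Z s'‖
          ≤ ‖dobnerGammaT t s'‖⁻¹ * (1 / (m + 1) * ‖dobnerGammaT t s'‖) := by gcongr
        _ = 1 / (m + 1) := by field_simp [norm_ne_zero_iff.2 hγ]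
    have e2 : ‖Z s - Z s'‖ < 1 / (m + 1) := hTbohr m s hs
    calc dist (Z s) (g m s) = ‖(Z s - Z s') - (g m s - Z s')‖ := by
          rw [dist_eq_norm]; congr 1; ring
      _ ≤ ‖Z s - Z s'‖ + ‖g m s - Z s'‖ := norm_sub_le _ _
      _ < 1 / (m + 1) + 1 / (m + 1) := add_lt_add_of_lt_of_le e2 e1
      _ = 2 * (1 / ((m : ℝ) + 1)) := by ring
      _ < ε := hεm
  -- holomorphy of `g_m` near the disc
  have hdiff : ∀ᶠ m in atTop, DiffContOnCl ℂ (g m) (ball s₀ r) := by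
    refine Eventually.of_forall fun m ↦ ?_
    have hU : IsOpen {s : ℂ | 0 < (s + T m * I).im} :=
      isOpen_lt continuous_const (Complex.continuous_im.comp (by fun_prop))
    have hsub : closedBall s₀ r ⊆ {s : ℂ | 0 < (s + T m * I).im} := fun s hs ↦ by
      have := (him_shift m s hs).1
      simp only [mem_setOf_eq]
      linarith
    have hd : DifferentiableOn ℂ (g m) {s : ℂ | 0 < (s + T m * I).im} := by
      intro s hs
      simp only [mem_setOf_eq] at hs
      refine DifferentiableAt.differentiableWithinAt ?_
      have hshift : DifferentiableAt ℂ (fun s : ℂ ↦ s + T m * I) s := by fun_prop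
      have hJ : DifferentiableAt ℂ (fun s : ℂ ↦ dobnerJ t (s + T m * I)) s :=
        DifferentiableAt.comp (f := fun s : ℂ ↦ s + T m * I) (g := dobnerJ t) s
          (differentiableAt_dobnerJ t hs) hshift
      have hξ : DifferentiableAt ℂ (fun s : ℂ ↦ xiDeformed t (dobnerJ t (s + T m * I))) s :=
        DifferentiableAt.comp (f := fun s : ℂ ↦ dobnerJ t (s + T m * I)) (g := xiDeformed t) s
          ((differentiable_xiDeformed t) _) hJ
      have hγ' : DifferentiableAt ℂ (fun s : ℂ ↦ dobnerGammaT t (s + T m * I)) s :=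
        DifferentiableAt.comp (f := fun s : ℂ ↦ s + T m * I) (g := dobnerGammaT t) s
          (differentiableAt_dobnerGammaT t hs) hshift
      have hγ : DifferentiableAt ℂ (fun s : ℂ ↦ (dobnerGammaT t (s + T m * I))⁻¹) s :=
        hγ'.inv (dobnerGammaT_ne_zero t hs.ne')
      exact hξ.mul hγ
    exact hd.diffContOnCl_ball hsub
  -- Hurwitz
  have hcont : ContinuousOn Z (sphere s₀ r) := hZd.continuous.continuousOn
  have hz := Complex.eventually_exists_zero_mem_ball_of_tendstoUniformlyOn hr0 hdiff hunif hcont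
    hs₀ hsphere
  obtain ⟨m, s, hs, hgs⟩ := hz.exists
  -- unwind: a zero of `H_t` off the real axis
  have hs' : s ∈ closedBall s₀ r := ball_subset_closedBall hs
  set s' : ℂ := s + T m * I with hs'def
  obtain ⟨him1, himT⟩ := him_shift m s hs'
  have hγ : dobnerGammaT t s' ≠ 0 := dobnerGammaT_ne_zero t (by linarith)
  have hξ : xiDeformed t (dobnerJ t s') = 0 := by
    simp only [hg] at hgs
    exact (mul_eq_zero.1 hgs).resolve_right (inv_ne_zero hγ)
  rw [xiDeformed_eq_zero_iff] at hξ
  have hreal' := hreal _ hξ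
  rw [im_neg_I_mul, dobnerJ_re] at hreal'
  -- `Re J_t(s') > 1/2`: contradiction
  have hre : s₀.re - 1 ≤ s'.re := by
    have : |s.re - s₀.re| ≤ 1 := (abs_re_im_sub_le_of_mem_closedBall hs').1.trans hr1
    rw [hs'def]
    simp only [Complex.add_re, Complex.mul_re, Complex.ofReal_re, Complex.I_re, mul_zero,
      Complex.ofReal_im, Complex.I_im, mul_one, sub_self, add_zero]
    linarith [(abs_le.1 this).1]
  have hnorm : 2 * Real.pi * Real.exp A + 1 ≤ ‖s'‖ := by
    have h1 : s'.im ≤ ‖s'‖ := (le_abs_self _).trans (abs_im_le_norm s')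
    have h2 : Y ≤ T m := hTY m
    rw [hY] at h2
    linarith
  have hpos : 0 < 2 * Real.pi * Real.exp A := by positivity
  have hn0 : 0 < ‖s'‖ / (2 * Real.pi) := div_pos (by linarith) (by positivity)
  have hlog : A < Real.log (‖s'‖ / (2 * Real.pi)) := by
    rw [Real.lt_log_iff_exp_lt hn0, lt_div_iff₀ (by positivity)]
    linarith
  have hkey : 3 / 2 - s₀.re < |t| / 4 * Real.log (‖s'‖ / (2 * Real.pi)) := by
    have := mul_lt_mul_of_pos_left hlog (by positivity : (0 : ℝ) < |t| / 4)
    rwa [show |t| / 4 * A = 3 / 2 - s₀.re by rw [hA]; field_simp] at this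
  linarith

/-- **Newman's conjecture `Λ ≥ 0` (`Literature.NumberTheory.LFunctions.rodgers_tao`) from Dobner's Thm. 4 alone**: Lemma 3
(`dobner_zetaDeformed_exists_zero_holds`, `DobnerLemma3Proofs.lean`) and Bohr's theorem
(`bohr_almost_periodic_holds`, `BohrAlmostPeriodicProofs.lean`) are theorems of the tree.
[cite: Dobner2021, §3.1] -/
theorem rodgers_tao_of_dobner_thm4 (h4 : dobner_xiDeformed_approx) : LFunctions.rodgers_tao :=
  LFunctions.rodgers_tao_of_dobner dobner_zetaDeformed_exists_zero_holds h4 bohr_almost_periodic_holds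

end Literature.NumberTheory.LFunctions

end

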